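import Summits.ABC.ABC.Theses.RootDecompA
import HarnessLib

/-!
# Route RootDecompA — `Assembly` (item stmt-ABC-23788)

`SmoothHeavyABC → SmoothForgivenABC → ABC` (`Summit.ABC.ABC.Theses.RootDecompA.Assembly`), proved unconditionally: the route's
root pieces are its hypotheses, nothing else is assumed.  Cut by the y-smooth part of abc: the heavy cell is served by `SmoothHeavyABC` at ε/3, the light cell by forgiven abc at δ = ε/3 and the root extraction c^(1−ε/3) < K₂·rad^(1+ε/3).

The proof is the body of the route's deciding theorem `RootDecompA.closes` copied VERBATIM rather than
a citation of `closes`, so that this file keeps compiling under any later re-glue of the route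
(cell decomp-abc, writer LANDING LIST; D-0178 root decomposition, door A).  Bookkeeping only: nothing
here proves `ABC` or decides the route's declared residual.
-/

set_option linter.dupNamespace false

namespace Summit.ABC.ABC.Theorems

/-- Item stmt-ABC-23788, literally the route decl `RootDecompA.Assembly` (`SmoothHeavyABC → SmoothForgivenABC → ABC`). -/
theorem rootDecompA_assembly_proof : Summit.ABC.ABC.Theses.RootDecompA.Assembly := by
  unfold Summit.ABC.ABC.Theses.RootDecompA.Assembly
  intro hH hF
  rw [_root_.ABC_iff]
  obtain ⟨y, hF⟩ := hF
  have one_le_rad : ∀ a b c : ℕ,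
      (1 : ℝ) ≤ ((Literature.NumberTheory.DiophantineGeometry.rad a b c : ℕ) : ℝ) := by
    intro a b c
    have h : Literature.NumberTheory.DiophantineGeometry.rad a b c ≠ 0 := by
      rw [Literature.NumberTheory.DiophantineGeometry.rad_def]
      exact UniqueFactorizationMonoid.radical_ne_zero
    exact_mod_cast Nat.one_le_iff_ne_zero.mpr h
  suffices main : ∀ ε : ℝ, 0 < ε → ε ≤ 1 → ∃ C : ℝ, 0 < C ∧ ∀ a b c : ℕ,
      Literature.NumberTheory.DiophantineGeometry.IsABCTriple a b c →
      (c : ℝ) < C * ((Literature.NumberTheory.DiophantineGeometry.rad a b c : ℕ) : ℝ) ^ (1 + ε) by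
    intro ε hε
    obtain ⟨C, hC, h⟩ := main (min ε 1) (lt_min hε one_pos) (min_le_right _ _)
    refine ⟨C, hC, fun a b c habc => (h a b c habc).trans_le ?_⟩
    exact mul_le_mul_of_nonneg_left
      (Real.rpow_le_rpow_of_exponent_le (one_le_rad a b c) (by linarith [min_le_left ε 1])) hC.le
  intro ε hε hε1
  obtain ⟨K₁, hK₁, h₁⟩ := hH y (ε / 3) (by positivity)
  obtain ⟨K₂, hK₂, h₂⟩ := hF (ε / 3) (by positivity)
  have hη1 : 0 < 1 - ε / 3 := by linarith
  have hexpo : (1 + ε / 3) * (1 - ε / 3)⁻¹ ≤ 1 + ε := by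
    rw [← div_eq_mul_inv, div_le_iff₀ hη1]
    nlinarith
  refine ⟨max K₁ (K₂ ^ (1 - ε / 3)⁻¹), lt_max_of_lt_left hK₁, fun a b c habc => ?_⟩
  have hR := one_le_rad a b c
  have hR0 : (0 : ℝ) ≤ ((Literature.NumberTheory.DiophantineGeometry.rad a b c : ℕ) : ℝ) := by linarith
  have hc0 : (0 : ℝ) < (c : ℝ) := by
    obtain ⟨ha, -, hab, -⟩ := habc
    exact_mod_cast (show 0 < c by omega)
  have hRε : ((Literature.NumberTheory.DiophantineGeometry.rad a b c : ℕ) : ℝ) ^ (1 + ε / 3) ≤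
      ((Literature.NumberTheory.DiophantineGeometry.rad a b c : ℕ) : ℝ) ^ (1 + ε) :=
    Real.rpow_le_rpow_of_exponent_le hR (by linarith)
  have hRpos : (0 : ℝ) < ((Literature.NumberTheory.DiophantineGeometry.rad a b c : ℕ) : ℝ) ^ (1 + ε) :=
    Real.rpow_pos_of_pos (by linarith) _
  by_cases hcell : (c : ℝ) ^ (ε / 3) ≤
      ((∏ p ∈ (a * b * c).primeFactors with p ≤ y, p ^ (a * b * c).factorization p : ℕ) : ℝ)
  · calc (c : ℝ) < K₁ * ((Literature.NumberTheory.DiophantineGeometry.rad a b c : ℕ) : ℝ) ^ (1 + ε / 3) :=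
          h₁ a b c habc hcell
      _ ≤ K₁ * ((Literature.NumberTheory.DiophantineGeometry.rad a b c : ℕ) : ℝ) ^ (1 + ε) :=
          mul_le_mul_of_nonneg_left hRε hK₁.le
      _ ≤ max K₁ (K₂ ^ (1 - ε / 3)⁻¹) *
            ((Literature.NumberTheory.DiophantineGeometry.rad a b c : ℕ) : ℝ) ^ (1 + ε) :=
          mul_le_mul_of_nonneg_right (le_max_left _ _) hRpos.le
  · push Not at hcell
    have hcη : 0 < (c : ℝ) ^ (ε / 3) := Real.rpow_pos_of_pos hc0 _
    have hR3 : 0 < ((Literature.NumberTheory.DiophantineGeometry.rad a b c : ℕ) : ℝ) ^ (1 + ε / 3) :=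
      Real.rpow_pos_of_pos (by linarith) _
    have hlt : (c : ℝ) < K₂ * (c : ℝ) ^ (ε / 3) *
        ((Literature.NumberTheory.DiophantineGeometry.rad a b c : ℕ) : ℝ) ^ (1 + ε / 3) := by
      calc (c : ℝ) < K₂ *
            ((∏ p ∈ (a * b * c).primeFactors with p ≤ y, p ^ (a * b * c).factorization p : ℕ) : ℝ) *
            ((Literature.NumberTheory.DiophantineGeometry.rad a b c : ℕ) : ℝ) ^ (1 + ε / 3) := h₂ a b c habc
        _ ≤ K₂ * (c : ℝ) ^ (ε / 3) *
            ((Literature.NumberTheory.DiophantineGeometry.rad a b c : ℕ) : ℝ) ^ (1 + ε / 3) := by gcongr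
    have hpow : (c : ℝ) ^ (1 - ε / 3) <
        K₂ * ((Literature.NumberTheory.DiophantineGeometry.rad a b c : ℕ) : ℝ) ^ (1 + ε / 3) := by
      rw [Real.rpow_sub hc0, Real.rpow_one, div_lt_iff₀ hcη]
      calc (c : ℝ) < K₂ * (c : ℝ) ^ (ε / 3) *
            ((Literature.NumberTheory.DiophantineGeometry.rad a b c : ℕ) : ℝ) ^ (1 + ε / 3) := hlt
        _ = K₂ * ((Literature.NumberTheory.DiophantineGeometry.rad a b c : ℕ) : ℝ) ^ (1 + ε / 3) *
            (c : ℝ) ^ (ε / 3) := by ring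
    have hinv : 0 < (1 - ε / 3)⁻¹ := inv_pos.mpr hη1
    have hc1η : 0 ≤ (c : ℝ) ^ (1 - ε / 3) := (Real.rpow_pos_of_pos hc0 _).le
    have hroot : (c : ℝ) = ((c : ℝ) ^ (1 - ε / 3)) ^ (1 - ε / 3)⁻¹ :=
      (Real.rpow_rpow_inv hc0.le hη1.ne').symm
    have hstep : ((c : ℝ) ^ (1 - ε / 3)) ^ (1 - ε / 3)⁻¹ <
        (K₂ * ((Literature.NumberTheory.DiophantineGeometry.rad a b c : ℕ) : ℝ) ^ (1 + ε / 3)) ^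
          (1 - ε / 3)⁻¹ :=
      Real.rpow_lt_rpow hc1η hpow hinv
    have hsplit : (K₂ * ((Literature.NumberTheory.DiophantineGeometry.rad a b c : ℕ) : ℝ) ^ (1 + ε / 3)) ^
          (1 - ε / 3)⁻¹ =
        K₂ ^ (1 - ε / 3)⁻¹ * ((Literature.NumberTheory.DiophantineGeometry.rad a b c : ℕ) : ℝ) ^
          ((1 + ε / 3) * (1 - ε / 3)⁻¹) := by
      rw [Real.mul_rpow hK₂.le hR3.le, ← Real.rpow_mul hR0]
    have hexp : ((Literature.NumberTheory.DiophantineGeometry.rad a b c : ℕ) : ℝ) ^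
          ((1 + ε / 3) * (1 - ε / 3)⁻¹) ≤
        ((Literature.NumberTheory.DiophantineGeometry.rad a b c : ℕ) : ℝ) ^ (1 + ε) :=
      Real.rpow_le_rpow_of_exponent_le hR hexpo
    have hK₂' : 0 ≤ K₂ ^ (1 - ε / 3)⁻¹ := (Real.rpow_pos_of_pos hK₂ _).le
    calc (c : ℝ) = ((c : ℝ) ^ (1 - ε / 3)) ^ (1 - ε / 3)⁻¹ := hroot
      _ < (K₂ * ((Literature.NumberTheory.DiophantineGeometry.rad a b c : ℕ) : ℝ) ^ (1 + ε / 3)) ^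
            (1 - ε / 3)⁻¹ := hstep
      _ = K₂ ^ (1 - ε / 3)⁻¹ * ((Literature.NumberTheory.DiophantineGeometry.rad a b c : ℕ) : ℝ) ^
            ((1 + ε / 3) * (1 - ε / 3)⁻¹) := hsplit
      _ ≤ K₂ ^ (1 - ε / 3)⁻¹ *
            ((Literature.NumberTheory.DiophantineGeometry.rad a b c : ℕ) : ℝ) ^ (1 + ε) :=
          mul_le_mul_of_nonneg_left hexp hK₂'
      _ ≤ max K₁ (K₂ ^ (1 - ε / 3)⁻¹) *
            ((Literature.NumberTheory.DiophantineGeometry.rad a b c : ℕ) : ℝ) ^ (1 + ε) :=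
          mul_le_mul_of_nonneg_right (le_max_right _ _) hRpos.le

end Summit.ABC.ABC.Theorems
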